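/-
COR-CM (cell pub-hodgecm2, stage 2 of the Hodge ladder) — lane V-TRANSPORT (seat b06 gen 22; count-neutral, no
BINDER-OWNERS row, no E term, no display of record; Interfaces (C1) untouched; wording of record untouched).
ROW B `TowerRelabel` of the junction-B01 ideation memo IDEA-1g (b01-idea-1 gen 7, route L1g-B) PROVED on the universe of
record: the tower embedding `ι₁` is a removable binder up to `Aut(L)` — `PeriodNV ι₁ V … → PeriodNV (ι₁ ∘ h⁻¹) V' …` for every
`h ∈ Aut(L)` and every `V'` (`[L:ℚ] > 2`).  CREDIT: row B and its use (orbit normal form) are b01-idea-1 gen 7's.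
Wording of record (verbatim, unchanged by this file): HC_CM follows in the kernel from BallQuotientUniformised ∧ PerLFace(model universe of record).
T5: consistency check by b06 g22 2026-08-21T18:22Z — BY INHABITATION: the only named-fact hypothesis binders of the new theorems are the four universe-of-record records `exists_isReal_hodgeModel` / `hodgePQ_independent_of_hodgeModel` / `BallQuotientUniformised` (resp. `BallQuotientUniformisedDatum`) / `CMAbelianVarietyRealised`, all DISCHARGED tree theorems (`exists_isReal_hodgeModel_holds`, `hodgePQ_independent_of_hodgeModel_holds`, `BallQuotient.ballQuotientUniformised_holds` / `ballQuotientUniformisedDatum_of`, `cmAbelianVarietyRealised_holds`), so their conjunction is inhabited and no contradiction is derivable; the remaining binders are data and elementary side conditions (`2 < finrank ℚ L`, `IsGalois ℚ F`, `finrank ℚ F = 6`, a `PeriodNV`/`PerL` ANTECEDENT of the same open kind as the conclusion — transports, no supply hypothesis, no hand-summarised Literature binder) — no contradiction derived.  HC_CM is NOT proved.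
-/
import Summits.HodgeConjecture.CorCM.HermSpaceRelabel
import Summits.HodgeConjecture.CorCM.TowerTransport
import HarnessLib

/-!
# COR-CM — relabelled towers are isomorphic: `P(h V, h Γ)` over `ι₁ ∘ h⁻¹` is `P(V, Γ)` over `ι₁`

For a CM field `L` with `[L:ℚ] > 2`, `h : L ≃+* L`, `V : HermSpace3 L ι₁` and a level `Γ`, the relabelled datum
`(V.relabel h, Γ.relabel h)` over `ι₁ ∘ h⁻¹` (`CorCM/HermSpaceRelabel.lean`) has the SAME complex Gram matrix and the SAME complex
arithmetic group as `(V, Γ)` over `ι₁`; hence (Literature `UnitaryBallIsometricQuotients` with `g = 1`) the two compact Picard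
modular surfaces of the universe of record are joined by a morphism `e` over `[v] ↦ [v]` with `e^*` bijective on every `Hᵏ`
and `tr ∘ e^* = d • tr`, `d ≠ 0`:

* §1 (scheme level) `Model.ballDatum_relabel_Hℂ_eq`, `Model.ballDatum_relabel_Γ_eq`, `Model.exists_hom_pms_relabel`;
* §2 (universes) **`Model.universeOf_towerRelabel_of_two_lt`** / **`Model.towerRelabel_of_two_lt`** (row B of IDEA-1g with the
  explicit witness `V' = V.relabel h`, `Γ' = Γ.relabel h`; all `V'` then follow from row A `Model.towerDominance_of_two_lt`),
  **`Model.periodNV_relabel`**: `PeriodNV ι₁ V K Ψ σ → PeriodNV (ι₁ ∘ h⁻¹) V' K Ψ σ` for every `V'` — same targets, forms and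
  eigencharacter.

With row A (`TowerTransport`), row C (b07 `PeriodCharacterTransport`) and row T (IDEA-1g-Sketch §8) this is the last data-binder
transport of the «one tower per field» normal form; it creates no period.  Theorems only; nothing cited as a record.
-/

noncomputable section

open scoped TensorProduct Matrix ComplexOrder
open NumberField CategoryTheory
open Literature.AlgebraicGeometry.Motives
open Literature.AlgebraicGeometry.ShimuraVarieties
open Literature.AlgebraicGeometry.HodgeTheory
open Literature.NumberTheory.Automorphic
open Literature.NumberTheory.Transcendental (arapura2012_cor_15_4_6_holds)

namespace Summit.HodgeConjecture.CorCM

namespace Model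

open Literature.NumberTheory.Automorphic.PicardCM

/-! ### §1 The relabelled ball datum (scheme level) -/

section Data

variable (hU : BallQuotientUniformisedDatum) (h₃ : CMAbelianVarietyRealised)
variable {L : CMField} {ι₁ : L →+* ℂ} {V : HermSpace3 L ι₁}

/-- **Same complex Gram matrix** for the ball data of `P(h V, h Γ)` (over `ι₁ ∘ h⁻¹`) and `P(V, Γ)` (over `ι₁`). [folklore] -/
theorem ballDatum_relabel_Hℂ_eq (Γ : Level V) (h : L ≃+* L)
    (h' : (pmsCode L (ι₁.comp h.symm.toRingHom) (V.relabel h) (Γ.relabel h)).IsAnisotropic)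
    (hV : (pmsCode L ι₁ V Γ).IsAnisotropic) :
    (Var.ballDatum hU h₃ (pmsCode L (ι₁.comp h.symm.toRingHom) (V.relabel h) (Γ.relabel h)) h').Hℂ =
      (Var.ballDatum hU h₃ (pmsCode L ι₁ V Γ) hV).Hℂ := by
  rw [ballDatum_Hℂ hU h₃ (Γ.relabel h) h', ballDatum_Hℂ hU h₃ Γ hV, HermSpace3.relabel_map_ι]

/-- **Same complex group** (clause `datum_Γ`, twice, and `Level.map_ι_relabel_Γ`), stated in the conjugate-equal form with
`g = 1` expected by `UnitaryBallIsometricQuotients`. [folklore] -/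
theorem ballDatum_relabel_Γ_eq (Γ : Level V) (h : L ≃+* L)
    (h' : (pmsCode L (ι₁.comp h.symm.toRingHom) (V.relabel h) (Γ.relabel h)).IsAnisotropic)
    (hV : (pmsCode L ι₁ V Γ).IsAnisotropic) :
    ((Var.ballDatum hU h₃ (pmsCode L (ι₁.comp h.symm.toRingHom) (V.relabel h) (Γ.relabel h)) h').Γ.map
        (Matrix.GeneralLinearGroup.map
          (Var.ballDatum hU h₃ (pmsCode L (ι₁.comp h.symm.toRingHom) (V.relabel h) (Γ.relabel h)) h').τ₁)).map
        (MulAut.conj (1 : GL (Fin 3) ℂ)).toMonoidHom =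
      (Var.ballDatum hU h₃ (pmsCode L ι₁ V Γ) hV).Γ.map
        (Matrix.GeneralLinearGroup.map (Var.ballDatum hU h₃ (pmsCode L ι₁ V Γ) hV).τ₁) := by
  have h1 : (MulAut.conj (1 : GL (Fin 3) ℂ)).toMonoidHom = MonoidHom.id _ := by
    ext x : 1
    simp
  rw [h1, Subgroup.map_id]
  change ((pmsRealisation hU _).datum h').Γ.map
      (Matrix.GeneralLinearGroup.map ((pmsRealisation hU _).datum h').E.subtype) =
    ((pmsRealisation hU _).datum hV).Γ.map
      (Matrix.GeneralLinearGroup.map ((pmsRealisation hU _).datum hV).E.subtype)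
  rw [(pmsRealisation hU (pmsCode L (ι₁.comp h.symm.toRingHom) (V.relabel h) (Γ.relabel h))).datum_Γ h',
    (pmsRealisation hU (pmsCode L ι₁ V Γ)).datum_Γ hV]
  change ((Γ.relabel h).Γ.map (Matrix.GeneralLinearGroup.map (ι₁.comp h.symm.toRingHom).rangeRestrictFieldEquiv.toRingHom)).map
      (Matrix.GeneralLinearGroup.map (ι₁.comp h.symm.toRingHom).fieldRange.subtype) =
    (Γ.Γ.map (Matrix.GeneralLinearGroup.map ι₁.rangeRestrictFieldEquiv.toRingHom)).map
      (Matrix.GeneralLinearGroup.map ι₁.fieldRange.subtype)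
  have hΦ : ∀ (ι : L →+* ℂ),
      (Matrix.GeneralLinearGroup.map (ι.fieldRange.subtype : ι.fieldRange →+* ℂ)).comp
          (Matrix.GeneralLinearGroup.map (n := Fin 3) ι.rangeRestrictFieldEquiv.toRingHom) =
        Matrix.GeneralLinearGroup.map ι := fun ι ↦ by
    ext δ i j
    rfl
  rw [Subgroup.map_map, Subgroup.map_map, hΦ, hΦ, Level.map_ι_relabel_Γ]

/-- **The relabelling morphism between the realising schemes** (anisotropic regime): a morphism
`e : P(h V, h Γ) ⟶ P(V, Γ)` over `[v] ↦ [v]` whose pull-back on `Hⁱ(−(ℂ); ℚ)` is bijective in every degree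
(Literature `UnitaryBallIsometricQuotients.exists_hom_bettiCohomology_bijective` with `g = 1`). [cite: Shimura1973, §7.2–7.3] -/
theorem exists_hom_pms_relabel (hHD : exists_isReal_hodgeModel) (Γ : Level V) (h : L ≃+* L)
    (h' : (pmsCode L (ι₁.comp h.symm.toRingHom) (V.relabel h) (Γ.relabel h)).IsAnisotropic)
    (hV : (pmsCode L ι₁ V Γ).IsAnisotropic) :
    ∃ e : Var.scheme hU h₃ (.pms (pmsCode L (ι₁.comp h.symm.toRingHom) (V.relabel h) (Γ.relabel h))) ⟶
        Var.scheme hU h₃ (.pms (pmsCode L ι₁ V Γ)),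
      ∀ i : ℕ, Function.Bijective (bettiCohomology.map e i).hom := by
  have hg : ((1 : GL (Fin 3) ℂ) : Matrix (Fin 3) (Fin 3) ℂ)ᴴ * (Var.ballDatum hU h₃ (pmsCode L ι₁ V Γ) hV).Hℂ *
      ((1 : GL (Fin 3) ℂ) : Matrix (Fin 3) (Fin 3) ℂ) =
      (Var.ballDatum hU h₃ (pmsCode L (ι₁.comp h.symm.toRingHom) (V.relabel h) (Γ.relabel h)) h').Hℂ := by
    rw [Units.val_one, Matrix.conjTranspose_one, Matrix.one_mul, Matrix.mul_one, ballDatum_relabel_Hℂ_eq hU h₃ Γ h h' hV]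
  obtain ⟨e, -, he⟩ := UnitaryBallIsometricQuotients.exists_hom_bettiCohomology_bijective arapura2012_cor_15_4_6_holds
    ⟨BettiUniverse.realHodgeModel hHD (Var.isSmoothProjective hU h₃
      (.pms (pmsCode L (ι₁.comp h.symm.toRingHom) (V.relabel h) (Γ.relabel h))))⟩
    ⟨BettiUniverse.realHodgeModel hHD (Var.isSmoothProjective hU h₃ (.pms (pmsCode L ι₁ V Γ)))⟩ hg
    (ballDatum_relabel_Γ_eq hU h₃ Γ h h' hV)
  exact ⟨e, he⟩

end Data

/-! ### §2 On `universeOf` and on the universe of record -/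

section Universe

variable (hHD : exists_isReal_hodgeModel) (hI : hodgePQ_independent_of_hodgeModel)
  (hU : BallQuotientUniformisedDatum) (h₃ : CMAbelianVarietyRealised)

/-- **Row B (`TowerRelabel`) of IDEA-1g on `universeOf`, for `[L:ℚ] > 2`**, with the explicit witness: the surface
`P(V.relabel h, Γ.relabel h)` of the `ι₁ ∘ h⁻¹`-tower maps to `P(V, Γ)` by a morphism `e` with `U.tr _ 4 ∘ₗ U.pull e 4 = d • U.tr _ 4`,
`d ≠ 0`. [cite: Shimura1973, §7.2–7.3] -/
theorem universeOf_towerRelabel_of_two_lt {L : CMField} (hL : 2 < Module.finrank ℚ L) {ι₁ : L →+* ℂ} (h : L ≃+* L)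
    (V : HermSpace3 L ι₁) (Γ : Level V) :
    ∃ (e : (universeOf hHD hI hU h₃).Mor
        ((universeOf hHD hI hU h₃).pms L (ι₁.comp h.symm.toRingHom) (V.relabel h) (Γ.relabel h))
        ((universeOf hHD hI hU h₃).pms L ι₁ V Γ)) (d : ℚ), d ≠ 0 ∧
      (universeOf hHD hI hU h₃).tr ((universeOf hHD hI hU h₃).pms L (ι₁.comp h.symm.toRingHom) (V.relabel h)
          (Γ.relabel h)) 4 ∘ₗ (universeOf hHD hI hU h₃).pull e 4 =
        d • (universeOf hHD hI hU h₃).tr ((universeOf hHD hI hU h₃).pms L ι₁ V Γ) 4 := by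
  obtain ⟨e, he⟩ := exists_hom_pms_relabel hU h₃ hHD Γ h (isAnisotropic_pmsCode_of_two_lt hL _)
    (isAnisotropic_pmsCode_of_two_lt hL Γ)
  obtain ⟨d, hd, hde⟩ := exists_tr_comp_pull_eq_smul
    (Var.isSmoothProjective hU h₃ (.pms (pmsCode L ι₁ V Γ)))
    (Var.isSmoothProjective hU h₃ (.pms (pmsCode L (ι₁.comp h.symm.toRingHom) (V.relabel h) (Γ.relabel h))))
    e (he 4).1
  exact ⟨e, d, hd, hde⟩

/-- **`PeriodNV` is transported along `h ∈ Aut(L)`** (`universeOf`, `[L:ℚ] > 2`): a non-zero period on some surface of the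
`(ι₁, V)`-tower gives one on a surface of the `(ι₁ ∘ h⁻¹, V')`-tower for EVERY `V'`, with the same targets, forms and
eigencharacter (relabel, then row A). [cite: Shimura1973, §7.2–7.3] -/
theorem universeOf_periodNV_relabel {L : CMField} (hL : 2 < Module.finrank ℚ L) {ι₁ : L →+* ℂ} (h : L ≃+* L)
    {V : HermSpace3 L ι₁} (V' : HermSpace3 L (ι₁.comp h.symm.toRingHom)) {K : CMField} {Ψ : Fin 4 → CMType K}
    {σ : K →+* ℂ} (hV : (universeOf hHD hI hU h₃).PeriodNV ι₁ V K Ψ σ) :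
    (universeOf hHD hI hU h₃).PeriodNV (ι₁.comp h.symm.toRingHom) V' K Ψ σ := by
  obtain ⟨Γ, F, α, hα, hper⟩ := hV
  obtain ⟨e, d, hd, he⟩ := universeOf_towerRelabel_of_two_lt hHD hI hU h₃ hL h V Γ
  exact universeOf_periodNV_transport hHD hI hU h₃ hL V'
    (Universe.periodNV_of_dominant (universeOf_fact_pull_comp hHD hI hU h₃) (universeOf_fact_pull_cup hHD hI hU h₃)
      e hd he F α hα hper)

end Universe

section EndState

variable (hHD : exists_isReal_hodgeModel) (hI : hodgePQ_independent_of_hodgeModel)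
  (h₁ : BallQuotientUniformised) (h₃ : CMAbelianVarietyRealised)

/-- **Row B (`TowerRelabel`) of IDEA-1g on the universe of record `picardCMUniverse hHD hI h₁ h₃`, for `[L:ℚ] > 2`** (with the
explicit witness `V' = V.relabel h`, `Γ' = Γ.relabel h`). [cite: Shimura1973, §7.2–7.3] -/
theorem towerRelabel_of_two_lt {L : CMField} (hL : 2 < Module.finrank ℚ L) {ι₁ : L →+* ℂ} (h : L ≃+* L)
    (V : HermSpace3 L ι₁) (Γ : Level V) :
    ∃ (e : (picardCMUniverse hHD hI h₁ h₃).Mor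
        ((picardCMUniverse hHD hI h₁ h₃).pms L (ι₁.comp h.symm.toRingHom) (V.relabel h) (Γ.relabel h))
        ((picardCMUniverse hHD hI h₁ h₃).pms L ι₁ V Γ)) (d : ℚ), d ≠ 0 ∧
      (picardCMUniverse hHD hI h₁ h₃).tr ((picardCMUniverse hHD hI h₁ h₃).pms L (ι₁.comp h.symm.toRingHom) (V.relabel h)
          (Γ.relabel h)) 4 ∘ₗ (picardCMUniverse hHD hI h₁ h₃).pull e 4 =
        d • (picardCMUniverse hHD hI h₁ h₃).tr ((picardCMUniverse hHD hI h₁ h₃).pms L ι₁ V Γ) 4 :=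
  universeOf_towerRelabel_of_two_lt hHD hI (ballQuotientUniformisedDatum_of h₁) h₃ hL h V Γ

/-- **`PeriodNV` of the universe of record is transported along `h ∈ Aut(L)` to every hermitian space over `ι₁ ∘ h⁻¹`**
(`[L:ℚ] > 2`). [cite: Shimura1973, §7.2–7.3] -/
theorem periodNV_relabel {L : CMField} (hL : 2 < Module.finrank ℚ L) {ι₁ : L →+* ℂ} (h : L ≃+* L)
    {V : HermSpace3 L ι₁} (V' : HermSpace3 L (ι₁.comp h.symm.toRingHom)) {K : CMField} {Ψ : Fin 4 → CMType K}
    {σ : K →+* ℂ} (hV : (picardCMUniverse hHD hI h₁ h₃).PeriodNV ι₁ V K Ψ σ) :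
    (picardCMUniverse hHD hI h₁ h₃).PeriodNV (ι₁.comp h.symm.toRingHom) V' K Ψ σ :=
  universeOf_periodNV_relabel hHD hI (ballQuotientUniformisedDatum_of h₁) h₃ hL h V' hV

end EndState

end Model

end Summit.HodgeConjecture.CorCM

end
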